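import Summits.Ventures.PercRepro.Night2NearFatFifteen

/-!
# night-2: h21's CELL `(2, 1)` AT `|G| = 14` WITH AT MOST ONE SIX-POINT LINE (gen 40)

At `|W| = 8` the non-suspect family lives at the top four levels (every load a distance-1 load, Night2NearFatTop).  A basis
line with four points of `W` (a six-point line of `V`) whose other basis lines have `≤ 3` points and whose classes have `≤ 5`:
the cell `ntpIncome 8 5 4 0 5 0 = 6221/6006` (`basis_pair_fair_eight_six_line`).  With every line of `V` of `≤ 5`, exactly `6`
or `≥ 8` points and any two six-point lines equal, a lossy basis pair has a four-point basis line (the pair above) or all basis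
lines `≤ 3` and classes `≤ 5` (`basis_pair_fair_top_eight`): **`localShadowHall_fourteen_of_one_six_line`**.
Paper: proofs/NIGHT-2-g40.md §10.
-/

namespace PercRepro.Shadow

open PercRepro.ThmH PercRepro.PerFlat

variable {α : Type*} [DecidableEq α] {M : Matroid α} [M.Finite] {G : Finset α}

/-- The cell `(4, 0, 5, 0)` at `N = 8`, `s = 5`: `6221/6006`. -/
theorem one_le_ntpIncome_eight_four_five : 1 ≤ ntpIncome 8 5 4 0 5 0 := by
  unfold ntpIncome suspBound
  simp only [Finset.sum_range_succ, Finset.sum_range_zero]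
  norm_num [Nat.choose, max_def]

/-- **A lossy basis pair with a four-point line `W ∩ cl {a, b}` at `|W| = 8`, its other basis lines of `≤ 3` points (or that
line) and its classes of `≤ 5`, is fair.** -/
theorem basis_pair_fair_eight_six_line (hG : G ∈ flatsQ M (5 + 1)) (hd : (gr M \ G).card = 2)
    (hk : kColoops M G = 1) (hs : ∀ e ∈ gr M, ∀ f ∈ gr M, e ≠ f → rkN M {e, f} = 2)
    (hl : ∀ e ∈ gr M, M.Indep {e}) (hnf : fatClosures M 5 G 2 = ∅)
    {B : Finset α} (hB : B ∈ thinMembers M 5 G) (hnP : ¬ bigP M G B) {z : α} (hz : z ∈ G \ clF M B)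
    (hl0 : loss M 5 G B z ≠ 0) (hW : (G \ insert z B).card = 8) {a b : α}
    (h4 : ((G \ insert z B) ∩ clF M {a, b}).card = 4)
    (h2 : ∀ a' ∈ insert z B \ coloops M G, ∀ b' ∈ insert z B \ coloops M G, a' ≠ b' →
      (G \ insert z B) ∩ clF M {a', b'} = (G \ insert z B) ∩ clF M {a, b} ∨
        ((G \ insert z B) ∩ clF M {a', b'}).card ≤ 3)
    (h1 : ∀ a' ∈ insert z B \ coloops M G, ∀ y ∈ G \ insert z B, ((G \ insert z B) ∩ clF M {a', y}).card ≤ 5) :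
    loss M 5 G B z ≤ rhoL M 5 G B z * lossIncomeH M 5 G (bigP M G) (dshGT2 M 5 G) B z := by
  obtain ⟨ℓ₁, ℓ₂, C₁, C₂, hℓ₁, hℓ₂, hB2, hB1, ho₁, ho₂, hℓℓ, hc₁, hc₂, hcc, -⟩ :=
    ntp_structure hG hd hk hs hl hB hnP hz (s := 5) (by norm_num) (by omega) (by omega)
  -- the long basis lines are `∅` or the four-point line
  have hd₁ : ℓ₁.card = 0 ∨ ℓ₁.card = 4 := by
    rcases ho₁ with rfl | ⟨h4', a', ha', b', hb', hab', rfl⟩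
    · exact Or.inl Finset.card_empty
    · rcases h2 a' ha' b' hb' hab' with h | h
      · right; rw [h]; exact h4
      · omega
  have hd₂ : ℓ₂.card = 0 ∨ ℓ₂.card = 4 := by
    rcases ho₂ with rfl | ⟨h4', a', ha', b', hb', hab', rfl⟩
    · exact Or.inl Finset.card_empty
    · rcases h2 a' ha' b' hb' hab' with h | h
      · right; rw [h]; exact h4
      · omega
  -- a four-point covering line is `W ∩ cl {a, b}`
  have key : ∀ m : Finset α, m = ℓ₁ ∨ m = ℓ₂ → m.card = 4 → m = (G \ insert z B) ∩ clF M {a, b} := by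
    intro m hm hm4
    have ho : m = ∅ ∨ (4 ≤ m.card ∧ ∃ a' ∈ insert z B \ coloops M G, ∃ b' ∈ insert z B \ coloops M G, a' ≠ b' ∧
        m = (G \ insert z B) ∩ clF M {a', b'}) := by
      rcases hm with rfl | rfl
      · exact ho₁
      · exact ho₂
    rcases ho with rfl | ⟨-, a', ha', b', hb', hab', rfl⟩
    · rw [Finset.card_empty] at hm4; omega
    · rcases h2 a' ha' b' hb' hab' with h | h
      · exact h
      · omega
  -- the classes: `∅` or five points; two of them cannot coexist
  have he₁ : C₁.card = 0 ∨ C₁.card = 5 := by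
    rcases hc₁ with rfl | ⟨h5, a', ha', y, hy, rfl⟩
    · exact Or.inl Finset.card_empty
    · right; have := h1 a' ha' y hy; omega
  have he₂ : C₂.card = 0 ∨ C₂.card = 5 := by
    rcases hc₂ with rfl | ⟨h5, a', ha', y, hy, rfl⟩
    · exact Or.inl Finset.card_empty
    · right; have := h1 a' ha' y hy; omega
  have hC₁W : C₁ ⊆ G \ insert z B := by
    rcases hc₁ with rfl | ⟨-, a', -, y, -, rfl⟩
    · exact Finset.empty_subset _
    · exact Finset.inter_subset_left
  have hC₂W : C₂ ⊆ G \ insert z B := by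
    rcases hc₂ with rfl | ⟨-, a', -, y, -, rfl⟩
    · exact Finset.empty_subset _
    · exact Finset.inter_subset_left
  have hone : ∃ C : Finset α, C.card ≤ 5 ∧
      ∀ a' ∈ insert z B \ coloops M G, ∀ y ∈ G \ insert z B,
        (G \ insert z B) ∩ clF M {a', y} ⊆ C ∨ ((G \ insert z B) ∩ clF M {a', y}).card + 1 ≤ 5 := by
    rcases hcc with heq | hint
    · refine ⟨C₁, by rcases he₁ with h | h <;> omega, ?_⟩
      intro a' ha' y hy
      rcases hB1 a' ha' y hy with h | h | h
      · exact Or.inl h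
      · exact Or.inl (heq ▸ h)
      · exact Or.inr h
    · have hone' : C₁.card = 0 ∨ C₂.card = 0 := by
        by_contra hno
        push Not at hno
        have hA := Finset.card_union_add_card_inter C₁ C₂
        have hU := Finset.card_le_card (Finset.union_subset hC₁W hC₂W)
        rcases he₁ with h | h
        · exact hno.1 h
        rcases he₂ with h' | h'
        · exact hno.2 h'
        omega
      rcases hone' with h0 | h0
      · refine ⟨C₂, by rcases he₂ with h | h <;> omega, ?_⟩
        intro a' ha' y hy
        rcases hB1 a' ha' y hy with h | h | h
        · right
          rw [Finset.card_eq_zero] at h0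
          rw [h0, Finset.subset_empty] at h
          rw [h, Finset.card_empty]
          norm_num
        · exact Or.inl h
        · exact Or.inr h
      · refine ⟨C₁, by rcases he₁ with h | h <;> omega, ?_⟩
        intro a' ha' y hy
        rcases hB1 a' ha' y hy with h | h | h
        · exact Or.inl h
        · right
          rw [Finset.card_eq_zero] at h0
          rw [h0, Finset.subset_empty] at h
          rw [h, Finset.card_empty]
          norm_num
        · exact Or.inr h
  obtain ⟨C, hC5, hB1'⟩ := hone
  have hB1'' : ∀ a' ∈ insert z B \ coloops M G, ∀ y ∈ G \ insert z B,
      (G \ insert z B) ∩ clF M {a', y} ⊆ C ∨ (G \ insert z B) ∩ clF M {a', y} ⊆ (∅ : Finset α) ∨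
        ((G \ insert z B) ∩ clF M {a', y}).card + 1 ≤ 5 := by
    intro a' ha' y hy
    rcases hB1' a' ha' y hy with h | h
    · exact Or.inl h
    · exact Or.inr (Or.inr h)
  have hdl : ∀ Y ⊆ G \ insert z B, 5 ≤ Y.card →
      ¬ ((∃ a ∈ insert z B \ coloops M G, ∃ b ∈ insert z B \ coloops M G, a ≠ b ∧
          Y.card ≤ (Y ∩ clF M {a, b}).card + 1) ∨
        ∃ a ∈ insert z B \ coloops M G, ∃ y ∈ Y, Y ⊆ clF M {a, y}) →
      dload M 5 G (bigP M G) (dshGT2 M 5 G) (insert z B ∪ Y) = 0 := by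
    intro Y hYW hYs hnS
    apply dload_eq_zero_of_shape_of_top hG hd hk hs hl hnf hB hnP hz hYW (by omega)
    · intro a' ha' b' hb' hab'
      by_contra hlt
      exact hnS (Or.inl ⟨a', ha', b', hb', hab', by omega⟩)
    · intro a' ha' y hy hsub
      exact hnS (Or.inr ⟨a', ha', y, hy, hsub⟩)
  -- the cells: `(4, 0)`, `(0, 4)` or `(0, 0)`, with `(ℓ, ∅)` when both covering lines are the four-point line
  rcases hd₁ with h₁0 | h₁4
  · rcases hd₂ with h₂0 | h₂4
    · apply basis_pair_fair_of_ntp hG hd hk hs hl hnf hB hnP hz hl0 (by norm_num : 1 ≤ 5) hdl hℓ₁ hℓ₂ hB2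
        (C₁ := C) (C₂ := ∅) hB1''
      rw [hW, h₁0, h₂0, Finset.card_empty]
      exact le_trans one_le_ntpIncome_eight_zero_six (ntpIncome_anti_e (by omega) le_rfl)
    · apply basis_pair_fair_of_ntp hG hd hk hs hl hnf hB hnP hz hl0 (by norm_num : 1 ≤ 5) hdl hℓ₁ hℓ₂ hB2
        (C₁ := C) (C₂ := ∅) hB1''
      rw [hW, h₁0, h₂4, Finset.card_empty, ntpIncome_comm]
      exact le_trans one_le_ntpIncome_eight_four_five (ntpIncome_anti_e hC5 le_rfl)
  · rcases hd₂ with h₂0 | h₂4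
    · apply basis_pair_fair_of_ntp hG hd hk hs hl hnf hB hnP hz hl0 (by norm_num : 1 ≤ 5) hdl hℓ₁ hℓ₂ hB2
        (C₁ := C) (C₂ := ∅) hB1''
      rw [hW, h₁4, h₂0, Finset.card_empty]
      exact le_trans one_le_ntpIncome_eight_four_five (ntpIncome_anti_e hC5 le_rfl)
    · -- both covering lines are the four-point line: `(ℓ₁, ∅)`
      have heq : ℓ₁ = ℓ₂ := by rw [key ℓ₁ (Or.inl rfl) h₁4, key ℓ₂ (Or.inr rfl) h₂4]
      have hB2' : ∀ a' ∈ insert z B \ coloops M G, ∀ b' ∈ insert z B \ coloops M G, a' ≠ b' →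
          (G \ insert z B) ∩ clF M {a', b'} ⊆ ℓ₁ ∨ (G \ insert z B) ∩ clF M {a', b'} ⊆ (∅ : Finset α) ∨
            ((G \ insert z B) ∩ clF M {a', b'}).card + 2 ≤ 5 := by
        intro a' ha' b' hb' hab'
        rcases hB2 a' ha' b' hb' hab' with h | h | h
        · exact Or.inl h
        · exact Or.inl (heq ▸ h)
        · exact Or.inr (Or.inr h)
      apply basis_pair_fair_of_ntp hG hd hk hs hl hnf hB hnP hz hl0 (by norm_num : 1 ≤ 5) hdl hℓ₁ (Finset.empty_subset _)
        hB2' (C₁ := C) (C₂ := ∅) hB1''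
      rw [hW, h₁4, Finset.card_empty]
      exact le_trans one_le_ntpIncome_eight_four_five (ntpIncome_anti_e hC5 le_rfl)

/-- **h21's cell `(2, 1)` at `|G| = 14` with at most one six-point line**: no fat closure, every line of `V` with `≤ 5`, exactly
`6` or `≥ 8` points, and any two six-point lines equal ⇒ the local Hall inequality. -/
theorem localShadowHall_fourteen_of_one_six_line (hG : G ∈ flatsQ M (5 + 1)) (hd : (gr M \ G).card = 2)
    (hk : kColoops M G = 1) (hs : ∀ e ∈ gr M, ∀ f ∈ gr M, e ≠ f → rkN M {e, f} = 2)
    (hl : ∀ e ∈ gr M, M.Indep {e}) (hnf : fatClosures M 5 G 2 = ∅) (h14 : G.card = 14)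
    (hline : ∀ u ∈ G \ coloops M G, ∀ v ∈ G \ coloops M G, u ≠ v →
      ((G \ coloops M G) ∩ clF M {u, v}).card ≤ 5 ∨ ((G \ coloops M G) ∩ clF M {u, v}).card = 6 ∨
        8 ≤ ((G \ coloops M G) ∩ clF M {u, v}).card)
    (hone : ∀ u ∈ G \ coloops M G, ∀ v ∈ G \ coloops M G, u ≠ v → ∀ u' ∈ G \ coloops M G, ∀ v' ∈ G \ coloops M G,
      u' ≠ v' → ((G \ coloops M G) ∩ clF M {u, v}).card = 6 → ((G \ coloops M G) ∩ clF M {u', v'}).card = 6 →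
      clF M {u, v} = clF M {u', v'}) :
    LocalShadowHall M 5 G := by
  by_cases hlong : ∃ u ∈ G \ coloops M G, ∃ v ∈ G \ coloops M G, u ≠ v ∧ 8 ≤ ((G \ coloops M G) ∩ clF M {u, v}).card
  · obtain ⟨u, hu, v, hv, huv, h8⟩ := hlong
    apply localShadowHall_of_long_line hG hd hk hs hl hu hv huv
    rw [card_sdiff_coloops_eq_sub_one hk]
    omega
  · push Not at hlong
    have hline' : ∀ u ∈ G \ coloops M G, ∀ v ∈ G \ coloops M G, u ≠ v →
        ((G \ coloops M G) ∩ clF M {u, v}).card ≤ 5 ∨ ((G \ coloops M G) ∩ clF M {u, v}).card = 6 := by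
      intro u hu v hv huv
      have := hlong u hu v hv huv
      rcases hline u hu v hv huv with h | h | h
      · exact Or.inl h
      · exact Or.inr h
      · omega
    have hfat : (fatClosures M 5 G 2).card ≤ 1 := by
      rw [hnf, Finset.card_empty]
      exact zero_le_one
    apply localShadowHall_of_gt2_of_basis_fair hG hd hk hs hl hfat
    intro B hB hnP z hz
    by_cases hl0 : loss M 5 G B z = 0
    · rw [hl0]
      have hd' : (gr M \ G).card ≤ 5 := by omega
      have h1 : 0 ≤ rhoL M 5 G B z := by
        unfold rhoL
        rw [hl0]
        simp
      have h2 : 0 ≤ lossIncomeH M 5 G (bigP M G) (dshGT2 M 5 G) B z :=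
        lossIncomeH_nonneg hG hd' (column_side_gt2 hG hd hk hs hl hfat) B z
      positivity
    · have hQG : insert z B ⊆ G := Finset.insert_subset (Finset.mem_sdiff.1 hz).1 (subset_G_of_mem_thinMembers hB)
      have hW := card_sdiff_insert_eq_card_sub_six hG hd hk hB hnP hz
      have hQ'V : ∀ a ∈ insert z B \ coloops M G, a ∈ G \ coloops M G := fun a ha =>
        Finset.mem_sdiff.2 ⟨hQG (Finset.mem_sdiff.1 ha).1, (Finset.mem_sdiff.1 ha).2⟩
      have hWV : ∀ y ∈ G \ insert z B, y ∈ G \ coloops M G := fun y hy =>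
        Finset.mem_sdiff.2 ⟨(Finset.mem_sdiff.1 hy).1, fun hK => (Finset.mem_sdiff.1 hy).2
          (Finset.mem_insert_of_mem (coloops_subset_of_mem_thinMembers hG (by omega) hB hK))⟩
      -- classes: `≤ 5` points of `W` always (a six-point line through a basis point has five off the basis)
      have hcls : ∀ a' ∈ insert z B \ coloops M G, ∀ y ∈ G \ insert z B, ((G \ insert z B) ∩ clF M {a', y}).card ≤ 5 := by
        intro a' ha' y hy
        have hay : a' ≠ y := fun h => (Finset.mem_sdiff.1 hy).2 (h ▸ (Finset.mem_sdiff.1 ha').1)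
        have h1 := card_inter_W_add_one_le hG hd hB hz ha' hy
        rcases hline' a' (hQ'V a' ha') y (hWV y hy) hay with h | h <;> omega
      by_cases hfour : ∃ a ∈ insert z B \ coloops M G, ∃ b ∈ insert z B \ coloops M G, a ≠ b ∧
          ((G \ insert z B) ∩ clF M {a, b}).card = 4
      · obtain ⟨a, ha, b, hb, hab, h4⟩ := hfour
        apply basis_pair_fair_eight_six_line hG hd hk hs hl hnf hB hnP hz hl0 (by omega) h4 _ hcls
        intro a' ha' b' hb' hab'
        have h2 := card_inter_W_add_two_le hG hd hB hz ha' hb' hab'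
        have h2ab := card_inter_W_add_two_le hG hd hB hz ha hb hab
        rcases hline' a' (hQ'V a' ha') b' (hQ'V b' hb') hab' with h | h
        · right; omega
        · -- a six-point line: it is THE six-point line `cl {a, b}`
          have h6ab : ((G \ coloops M G) ∩ clF M {a, b}).card = 6 := by
            rcases hline' a (hQ'V a ha) b (hQ'V b hb) hab with h' | h' <;> omega
          left
          rw [hone a' (hQ'V a' ha') b' (hQ'V b' hb') hab' a (hQ'V a ha) b (hQ'V b hb) hab h h6ab]
      · push Not at hfour
        apply basis_pair_fair_top_eight hG hd hk hs hl hnf hB hnP hz hl0 (by omega)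
        · intro a ha b hb hab
          have h2 := card_inter_W_add_two_le hG hd hB hz ha hb hab
          have h4 := hfour a ha b hb hab
          rcases hline' a (hQ'V a ha) b (hQ'V b hb) hab with h | h <;> omega
        · intro a ha y hy
          have := hcls a ha y hy
          omega

end PercRepro.Shadow
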